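import Summits.QuantumFields.YangMills.Theorems.BalabanUVNodesN15KingModelSlicesTorusNode
import Literature.MathematicalPhysics.QuantumFieldTheory.King1986.MinimizerDecayUniform

/-!
# BalabanUVNodes ∕ N15 — THE KING-MODEL RUNG, CURVED EDITION (PART M): THE EXACT-MASS FAMILY — part F's two-spacing rate of the
# slice with the mass quantified INSIDE the constants (`0 < m² ≤ m₀²`), and NE2's site layer, hypothesis-free, for the slices of
# King's decomposition (2.17) of `G^η_k` carrying their PHYSICAL mass `m²(L^jη)²` (King's (2.20)) — HONEST SCOPE (iii) of part F gone
# (Track A, DAG node N15 = NE2; FAN-OUT v1.1 §N15 s3 «KING-MODEL RUNG»)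

HONEST FRAMING.  Count-neutral kernel bookkeeping (cell `pub-ymgap`, seat `pub-ymgap-dag-n15-e` g5; `--supports stmt-QuantumFields-19912
--as helper` = K3‴ `SpineGivenEndpointR13`, lineage K3 19676 ∕ K3′ 19908).  TEMPLATE LITERATURE, `A = 0`: C. King's scalar U(1)-Higgs MODEL on
finite tori, NOT Bałaban's covariant objects; NE2⁺ is NOT PRINTED for those and not proved here; NOT a node discharge; nothing continuum ∕ ℝ⁴ ∕
OS ∕ mass-gap ∕ Clay.  0 `sorry`, standard axioms.

THE POINT.  Parts F ∕ G (p479910, p480293) proved the two-spacing rate and `NE2PlusSite` for the `A = 0` slice family with ONE mass `m²` in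
scale-`j` units for all members — HONEST SCOPE (iii): King's slice at scale `j` of the decomposition (2.17) of `G^η_k` carries the mass
`m²(L^jη)²` by the rescaling (2.20), and the tree's constants were «not stated uniformly in the mass».  They now are:
`Lit/Balaban1983to89/B4Thm110ZeroTorusUniform.thm110_zero_torus_unif` ([Ba 4] (1.10), mass inside under a cap) and
`Lit/King1986/MinimizerDecayUniform` (`minimiser_kernel_decay_blocks_unif`, `king_prop38_torus_blocks_unif`) — this seat, g5.  THIS FILE:
* §1 re-runs part F's factor bounds and assembly with the mass INSIDE: `ksH_decay_unif`, `ksH_rate_unif`, **`ksSlice_rate_unif`** — ONE `(C, δ)`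
  (functions of `d, L, a, m₀², γ`) with `|ksSlice′ − ksSlice| ≤ C·(L^{−γ∕2})^j·e^{−δ|B(x)−B(y)|_U}` for EVERY `0 < m² ≤ m₀²` and every index
  (the middle factor's constants `γ₀ − ρ − ρ_B`, `κ′`, `K₄₅`, `δ₄₅` were mass-free already);
* §2 THE EXACT-MASS FAMILY: the member at index `i` (volume exponent `e`, physical volume `2L^{m₀}`, slice `j`, so `k = j + (e+1−m₀)` scales and
  `L^jη = L^{−(e+1−m₀)}`) is part G's datum AT THE MASS `physMass = m²·L^{−2(e+1−m₀)} = m²(L^jη)²` (`kSliceIndexPhys`), i.e. — by part K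
  (`ksSlice_eq_sub`) — EXACTLY King's slice `G^ε_{(j)} = G^ε_{j+1} − G^ε_j` of the decomposition (2.17) of the fluctuation propagator `G^η_k`
  with physical mass `m²`, in scale-`j` lattice units; **`line1_kSlicesPhys`**, `etaRateIneqSite_kSlicesPhys`, **`ne2PlusSite_kSlicesPhys`**
  (hypothesis-free, ONE `(C, δ)` for the whole family), `ne2ZeroSite_kSlicesPhys`.
HONEST SCOPE.  (i) `A = 0`, periodic b.c., odd `L ≥ 3`, `m² > 0`, flat blocks; (ii) lattice units (part F (ii); physical reader: `(L^jη)^{2−d}`,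
part K v1.1 §5); (iii) — GONE for the slices `j ≥ 1`: each member is King's slice at its physical mass and the constants are uniform;
what is NOT here is the SUM over `j` (the full `G^η_k = G^η_1 + Σ_j G^η_{(j)}` two-spacing rate needs the `k`-fold tower on one torus —
`King1986.Torus.flatten` iterated — and `King1986/SliceSum`; successor); (iv) `j ≥ 1`; (v) not Bałaban's `G_k(U)`; not a discharge.
Locators: [King1986] C. King, CMP **102** (1986) 649–677: (2.17) p. 653, (2.20) p. 654, Thm 3.3 p. 658, Prop. 3.7 p. 663, Prop. 3.8 (3.71)
p. 664, Prop. 3.9 (3.73) p. 665, Lemma 4.5 (4.38) p. 674, (4.42)–(4.43) p. 675; [Ba 4] = [Balaban1983RegularityDecay] Thm (1.10) p. 573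
(«constants … depending on d, M only»).
-/

noncomputable section

namespace Summit.QuantumFields.YangMills.BalabanUVNodes.N15KingModelRung.Curved

open Real Finset Matrix
open Literature.MathematicalPhysics.QuantumFieldTheory.Balaban1983to89 (Params)
open Literature.MathematicalPhysics.QuantumFieldTheory.Balaban1983to89.T4EtaRate (EtaRateIneqSite NE2PlusSite)
open Literature.MathematicalPhysics.QuantumFieldTheory.Balaban1983to89.T4EtaRateSiteOfRatePair (NE2ZeroSite ne2ZeroSite_of_ne2PlusSite)
open Literature.MathematicalPhysics.QuantumFieldTheory.Balaban1983to89.B4Sect5Proof (latticeConst)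
open Literature.MathematicalPhysics.QuantumFieldTheory.Balaban1983to89.B5Prop11Plancherel (Tor fine)
open Literature.MathematicalPhysics.QuantumFieldTheory.King1986 (aK aK_le aK_pos prop38RateConst prop38PosConst lemma43Const)
open Literature.MathematicalPhysics.QuantumFieldTheory.King1986.ContinuumLimit (eps eps_pos eps_le_one)
open Literature.MathematicalPhysics.QuantumFieldTheory.King1986.Torus (blockOf blockOf_over tdistT tdistT_triangle tdistT_nonneg tdistT_symm
  tdistT_sumBound minimiser_kernel_decay_blocks_unif king_prop38_torus_blocks_unif king_lemma45_torus gam0L kapCT K45 delta45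
  K45_nonneg delta45_pos kapCT_pos_le)
open Summit.QuantumFields.YangMills.BalabanUVNodes.N15.KingModel (kingCov kingCov_abs_le kingCov_congrN kingRho kingRhoB kingRho_add_lt_gam0L)
open Summit.QuantumFields.YangMills.BalabanUVNodes.N18KingModelTorus (outerRate_le_unif)

variable {d : ℕ} (L : ℕ) [NeZero L]

/-! ## §1 Part F's factor bounds and assembly with the mass quantified inside -/

/-- **DECAY OF THE OUTER FACTORS, BOTH RUNS, UNIFORMLY IN THE INDEX AND IN THE MASS `0 ≤ m² ≤ m₀²`** ([Ba 4] (1.10) mass-uniform,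
`minimiser_kernel_decay_blocks_unif`, `a_K ≤ a`). [cite: King1986, Theorem 3.3 (3.7) p.658; Balaban1983RegularityDecay, Theorem (1.10) p.573] -/
theorem ksH_decay_unif (hLodd : Odd L) (hL : 2 ≤ L) {a : ℝ} (ha : 0 < a) {m0sq : ℝ} (hm0 : 0 ≤ m0sq) :
    ∃ δ₀ c : ℝ, 0 < δ₀ ∧ 0 < c ∧ ∀ (m2 : ℝ), 0 ≤ m2 → m2 ≤ m0sq → ∀ i : KSliceIdx d,
      (∀ (x : Tor (fine (L ^ i.j) (ksU L i))) (z : Tor (ksU L i)),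
        |ksH L a m2 i x z| ≤ c * Real.exp (-(δ₀ * tdistT (ksU L i) (blockOf (L ^ i.j) (ksU L i) x) z))) ∧
      (∀ (x' : Tor (fine (L ^ i.n * L ^ i.j) (ksU L i))) (z : Tor (ksU L i)),
        |ksH' L a m2 i x' z| ≤ c * Real.exp (-(δ₀ * tdistT (ksU L i) (blockOf (L ^ i.n * L ^ i.j) (ksU L i) x') z))) := by
  have hL1 : 1 < L := by omega
  have hLr : (1 : ℝ) < L := by exact_mod_cast hL1
  obtain ⟨δ₀, c₀, hδ₀, hc₀, H⟩ := minimiser_kernel_decay_blocks_unif (d + 1) L (Nat.succ_pos d) ⟨hLodd, hL1⟩ ha hm0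
  refine ⟨δ₀, a * c₀, hδ₀, mul_pos ha hc₀, fun m2 hm hcap i => ⟨fun x z => ?_, fun x' z => ?_⟩⟩
  · have h := H (i.params L hLodd hL) rfl rfl i.one_le_j m2 hm hcap (ksU L i) (ksU_eq_sitesPerDir L hLodd hL i) (L ^ i.j) rfl x z
    refine h.trans (mul_le_mul_of_nonneg_right ?_ (Real.exp_pos _).le)
    exact mul_le_mul_of_nonneg_right (aK_le ha hLr i.one_le_j) hc₀.le
  · have hjn : 1 ≤ i.j + i.n := by have := i.one_le_j; omega
    have h := H (i.paramsHi L hLodd hL) rfl rfl hjn m2 hm hcap (ksU L i) (ksU_eq_sitesPerDir_hi L hLodd hL i)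
      (L ^ i.n * L ^ i.j) (by show L ^ i.n * L ^ i.j = L ^ (i.j + i.n); rw [pow_add, mul_comm]) x' z
    refine h.trans (mul_le_mul_of_nonneg_right ?_ (Real.exp_pos _).le)
    exact mul_le_mul_of_nonneg_right (aK_le ha hLr hjn) hc₀.le

/-- **THE RATE OF THE OUTER FACTOR, UNIFORMLY IN THE INDEX AND IN THE MASS `0 < m² ≤ m₀²`** (Prop. 3.8 mass-uniform,
`king_prop38_torus_blocks_unif`, constant majorised in `(j, n)` by `outerRate_le_unif`). [cite: King1986, Prop. 3.8 (3.71) p.664, p.674] -/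
theorem ksH_rate_unif (hLodd : Odd L) (hL : 2 ≤ L) {a : ℝ} (ha : 0 < a) {m0sq : ℝ} (hm0 : 0 ≤ m0sq) {γ : ℝ} (hγ0 : 0 ≤ γ)
    (hγ1 : γ ≤ 1) :
    ∃ R δ : ℝ, 0 < R ∧ 0 < δ ∧ ∀ (m2 : ℝ), 0 < m2 → m2 ≤ m0sq →
      ∀ (i : KSliceIdx d) (x' : Tor (fine (L ^ i.n * L ^ i.j) (ksU L i))) (z : Tor (ksU L i)),
      |ksH' L a m2 i x' z - ksH L a m2 i (underPtN L i.j i.n (ksU L i) x') z|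
        ≤ R * (((L : ℝ) ^ (-(γ / 2))) ^ i.j)
          * Real.exp (-(δ * tdistT (ksU L i) (blockOf (L ^ i.j) (ksU L i) (underPtN L i.j i.n (ksU L i) x')) z)) := by
  obtain ⟨δ₀, c₀, hδ₀, hc₀, H⟩ := king_prop38_torus_blocks_unif (d + 1) L (Nat.succ_pos d) hLodd hL ha hm0 hγ0 hγ1
  set Cu : ℝ := prop38RateConst a a (a * (2 * ((a * (1 - ((L : ℝ) ^ 2)⁻¹))⁻¹ + π ^ 2 / 48 + 1 / 3)))
      ((π ^ 2 / 4) ^ (d + 1)) (d + 1) γ + prop38PosConst a ((π ^ 2 / 4) ^ (d + 1)) (d + 1) γ with hCu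
  refine ⟨Real.sqrt (2 * (a * c₀) * Cu) + 1, δ₀ / 2, by positivity, half_pos hδ₀, fun m2 hm hcap i x' z => ?_⟩
  have hj := H (i.params L hLodd hL) rfl rfl i.one_le_j m2 hm hcap i.n i.one_le_n (ksU L i) (ksU_eq_sitesPerDir L hLodd hL i)
    (underPtN L i.j i.n (ksU L i) x') x' z (val_underPtN L i.j i.n (ksU L i) x')
  set s : ℝ := (L : ℝ) ^ (-(γ / 2)) with hs_def
  have hs : 0 ≤ s := Real.rpow_nonneg (Nat.cast_nonneg _) _
  set E : ℝ := Real.exp (-(δ₀ / 2 * tdistT (ksU L i) (blockOf (L ^ i.j) (ksU L i) (underPtN L i.j i.n (ksU L i) x')) z)) with hE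
  have hstep : |ksH' L a m2 i x' z - ksH L a m2 i (underPtN L i.j i.n (ksU L i) x') z| ≤
      Real.sqrt ((prop38RateConst a a (lemma43Const a L i.j i.n) ((π ^ 2 / 4) ^ (d + 1)) (d + 1) γ
            + prop38PosConst a ((π ^ 2 / 4) ^ (d + 1)) (d + 1) γ) * ((L ^ i.j : ℕ) : ℝ) ^ (-γ) * (2 * (a * c₀))) * E := hj
  have hC := outerRate_le_unif (d := d + 1) (Nat.succ_pos d) ha hL i.one_le_j i.one_le_n hγ1 hc₀.le (K := i.j)
  calc |ksH' L a m2 i x' z - ksH L a m2 i (underPtN L i.j i.n (ksU L i) x') z|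
      ≤ Real.sqrt ((prop38RateConst a a (lemma43Const a L i.j i.n) ((π ^ 2 / 4) ^ (d + 1)) (d + 1) γ
            + prop38PosConst a ((π ^ 2 / 4) ^ (d + 1)) (d + 1) γ) * ((L ^ i.j : ℕ) : ℝ) ^ (-γ) * (2 * (a * c₀))) * E := hstep
    _ ≤ Real.sqrt (2 * (a * c₀) * Cu) * s ^ i.j * E := mul_le_mul_of_nonneg_right hC (Real.exp_pos _).le
    _ ≤ (Real.sqrt (2 * (a * c₀) * Cu) + 1) * s ^ i.j * E := by
        refine mul_le_mul_of_nonneg_right (mul_le_mul_of_nonneg_right (by linarith) (pow_nonneg hs _)) (Real.exp_pos _).le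

/-- **THE η-RATE OF THE `A = 0` SINGLE-SCALE PIECE, ONE `(C, δ)` FOR ALL MASSES `0 < m² ≤ m₀²`** (part F's `ksSlice_rate` — King's (4.43) on the
torus — with the mass quantified inside): for every `0 < m² ≤ m₀²`, every index and all fine points `x′, y′` over `x, y`,
`|ksSlice′(x′, y′) − ksSlice(x, y)| ≤ C·(L^{−γ∕2})^j·e^{−δ|B(x) − B(y)|_U}`.  The proof is part F's, fed §1's mass-uniform outer-factor bounds; the
middle factor's decay and Lemma-4.5 constants never depended on the mass. [cite: King1986, (4.42)–(4.43) p.675, Prop. 3.9 (3.73) p.665, (2.20) p.654] -/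
theorem ksSlice_rate_unif (hLodd : Odd L) (hL : 2 ≤ L) {a : ℝ} (ha : 0 < a) {m0sq : ℝ} (hm0 : 0 ≤ m0sq) {γ : ℝ} (hγ0 : 0 ≤ γ)
    (hγ1 : γ ≤ 1) :
    ∃ C δ : ℝ, 0 < C ∧ 0 < δ ∧ ∀ (m2 : ℝ), 0 < m2 → m2 ≤ m0sq →
      ∀ (i : KSliceIdx d) (x' y' : Tor (fine (L ^ i.n * L ^ i.j) (ksU L i))),
      |ksSlice' L a m2 i x' y' - ksSlice L a m2 i (underPtN L i.j i.n (ksU L i) x') (underPtN L i.j i.n (ksU L i) y')|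
        ≤ C * (((L : ℝ) ^ (-(γ / 2))) ^ i.j)
          * Real.exp (-(δ * tdistT (ksU L i) (blockOf (L ^ i.j) (ksU L i) (underPtN L i.j i.n (ksU L i) x'))
              (blockOf (L ^ i.j) (ksU L i) (underPtN L i.j i.n (ksU L i) y')))) := by
  have hL1 : 1 ≤ L := by omega
  obtain ⟨δ₀, cH, hδ₀, hcH, Hdec⟩ := ksH_decay_unif (d := d) L hLodd hL ha hm0
  obtain ⟨R, δ₁, hR, hδ₁, Hrate⟩ := ksH_rate_unif (d := d) L hLodd hL ha hm0 hγ0 hγ1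
  have hcC := ksC_const_pos (d := d) L hL ha
  obtain ⟨hκ', _⟩ := kapCT_pos_le (d := d + 1) ha hL
  have hδ45 := delta45_pos (d := d + 1) ha hL
  have hK45 := K45_nonneg (d := d + 1) a L
  obtain ⟨κ, hκ, hκ₀, hκ₁, hκC, hκ45⟩ : ∃ κ : ℝ, 0 < κ ∧ κ ≤ δ₀ ∧ κ ≤ δ₁ ∧ κ ≤ kapCT (d + 1) a L ∧ κ ≤ delta45 (d + 1) a L :=
    ⟨min (min δ₀ δ₁) (min (kapCT (d + 1) a L) (delta45 (d + 1) a L)), lt_min (lt_min hδ₀ hδ₁) (lt_min hκ' hδ45),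
      (min_le_left _ _).trans (min_le_left _ _), (min_le_left _ _).trans (min_le_right _ _),
      (min_le_right _ _).trans (min_le_left _ _), (min_le_right _ _).trans (min_le_right _ _)⟩
  have hs : 0 ≤ (L : ℝ) ^ (-(γ / 2)) := Real.rpow_nonneg (Nat.cast_nonneg _) _
  refine ⟨(2 * (R * (gam0L (d + 1) a L - (kingRho (d + 1) a L + kingRhoB (d + 1) a L))⁻¹ * cH) + cH * K45 (d + 1) a L * cH)
      * latticeConst (d + 1) (κ / 2) ^ 2 + 1, κ / 2, by positivity, half_pos hκ, fun m2 hm hcap i x' y' => ?_⟩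
  set cC : ℝ := (gam0L (d + 1) a L - (kingRho (d + 1) a L + kingRhoB (d + 1) a L))⁻¹ with hcC_def
  set V : ℝ := latticeConst (d + 1) (κ / 2) with hV_def
  set s : ℝ := (L : ℝ) ^ (-(γ / 2)) with hs_def
  set x := underPtN L i.j i.n (ksU L i) x' with hx
  set y := underPtN L i.j i.n (ksU L i) y' with hy
  set Bx := blockOf (L ^ i.j) (ksU L i) x with hBx
  set By := blockOf (L ^ i.j) (ksU L i) y with hBy
  have hBx' : blockOf (L ^ i.n * L ^ i.j) (ksU L i) x' = Bx := (blockOf_underPtN L i.j i.n (ksU L i) x').symm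
  have hBy' : blockOf (L ^ i.n * L ^ i.j) (ksU L i) y' = By := (blockOf_underPtN L i.j i.n (ksU L i) y').symm
  have ht0 := tdistT_nonneg (ksU L i)
  have hRs : 0 ≤ R * s ^ i.j := mul_nonneg hR.le (pow_nonneg hs _)
  have exp_rate_mono : ∀ {κ' r t : ℝ}, κ' ≤ r → 0 ≤ t → Real.exp (-(r * t)) ≤ Real.exp (-(κ' * t)) :=
    fun hκr ht => Real.exp_le_exp.mpr (by nlinarith)
  have hKL : 0 ≤ K45 (d + 1) a L * ((L : ℝ) ^ i.j)⁻¹ := mul_nonneg hK45 (inv_nonneg.mpr (pow_nonneg (Nat.cast_nonneg (α := ℝ) L) i.j))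
  have hA : ∀ z, |ksH L a m2 i x z| ≤ cH * Real.exp (-(κ * tdistT (ksU L i) Bx z)) := fun z =>
    ((Hdec m2 hm.le hcap i).1 x z).trans (mul_le_mul_of_nonneg_left (exp_rate_mono hκ₀ (ht0 _ _)) hcH.le)
  have hB' : ∀ w, |ksH' L a m2 i y' w| ≤ cH * Real.exp (-(κ * tdistT (ksU L i) w By)) := fun w => by
    rw [tdistT_symm, ← hBy']
    exact ((Hdec m2 hm.le hcap i).2 y' w).trans (mul_le_mul_of_nonneg_left (exp_rate_mono hκ₀ (ht0 _ _)) hcH.le)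
  have hCm : ∀ z w, |ksC L a m2 i z w| ≤ cC * Real.exp (-(κ * tdistT (ksU L i) z w)) := fun z w =>
    ((ksC_decay L hL ha hm i z w).1).trans (mul_le_mul_of_nonneg_left (exp_rate_mono hκC (ht0 _ _)) hcC.le)
  have hCm' : ∀ z w, |ksC' L a m2 i z w| ≤ cC * Real.exp (-(κ * tdistT (ksU L i) z w)) := fun z w =>
    ((ksC_decay L hL ha hm i z w).2).trans (mul_le_mul_of_nonneg_left (exp_rate_mono hκC (ht0 _ _)) hcC.le)
  have hdA : ∀ z, |ksH' L a m2 i x' z - ksH L a m2 i x z| ≤ R * s ^ i.j * Real.exp (-(κ * tdistT (ksU L i) Bx z)) := fun z =>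
    (Hrate m2 hm hcap i x' z).trans (mul_le_mul_of_nonneg_left (exp_rate_mono hκ₁ (ht0 _ _)) hRs)
  have hdB : ∀ w, |ksH' L a m2 i y' w - ksH L a m2 i y w| ≤ R * s ^ i.j * Real.exp (-(κ * tdistT (ksU L i) w By)) := fun w => by
    rw [tdistT_symm]
    exact (Hrate m2 hm hcap i y' w).trans (mul_le_mul_of_nonneg_left (exp_rate_mono hκ₁ (ht0 _ _)) hRs)
  have hdC : ∀ z w, |ksC' L a m2 i z w - ksC L a m2 i z w|
      ≤ K45 (d + 1) a L * ((L : ℝ) ^ i.j)⁻¹ * Real.exp (-(κ * tdistT (ksU L i) z w)) := fun z w =>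
    (ksC_rate L hL ha hm i z w).trans (mul_le_mul_of_nonneg_left (exp_rate_mono hκ45 (ht0 _ _)) hKL)
  have hVs : ∀ u : Tor (ksU L i), ∑ z, Real.exp (-(κ / 2 * tdistT (ksU L i) u z)) ≤ V := fun u =>
    tdistT_sumBound (ksU L i) (κ / 2) (half_pos hκ) u
  have key := triple_rate (tdistT (ksU L i)) ht0 (tdistT_triangle (ksU L i)) hκ.le hcH.le hRs hcC.le hKL hcH.le hRs
    hA hCm hCm' hB' hdA hdC hdB hVs
  have hE : 0 ≤ Real.exp (-(κ / 2 * tdistT (ksU L i) Bx By)) := (Real.exp_pos _).le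
  have hV0 : 0 ≤ V ^ 2 := sq_nonneg _
  have hLj : ((L : ℝ) ^ i.j)⁻¹ ≤ s ^ i.j := inv_pow_le_rate_pow hL1 (by linarith) i.j
  have hsj : 0 ≤ s ^ i.j := pow_nonneg hs _
  have hKs : cH * (K45 (d + 1) a L * ((L : ℝ) ^ i.j)⁻¹) * cH ≤ cH * (K45 (d + 1) a L * s ^ i.j) * cH :=
    mul_le_mul_of_nonneg_right (mul_le_mul_of_nonneg_left (mul_le_mul_of_nonneg_left hLj hK45) hcH.le) hcH.le
  have hsum : R * s ^ i.j * cC * cH + cH * (K45 (d + 1) a L * ((L : ℝ) ^ i.j)⁻¹) * cH + cH * cC * (R * s ^ i.j)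
      ≤ (2 * (R * cC * cH) + cH * K45 (d + 1) a L * cH) * s ^ i.j := by
    calc R * s ^ i.j * cC * cH + cH * (K45 (d + 1) a L * ((L : ℝ) ^ i.j)⁻¹) * cH + cH * cC * (R * s ^ i.j)
        ≤ R * s ^ i.j * cC * cH + cH * (K45 (d + 1) a L * s ^ i.j) * cH + cH * cC * (R * s ^ i.j) := by linarith [hKs]
      _ = (2 * (R * cC * cH) + cH * K45 (d + 1) a L * cH) * s ^ i.j := by ring
  calc |ksSlice' L a m2 i x' y' - ksSlice L a m2 i x y|
      = |triple (ksH' L a m2 i x') (ksC' L a m2 i) (ksH' L a m2 i y') - triple (ksH L a m2 i x) (ksC L a m2 i) (ksH L a m2 i y)| := rfl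
    _ ≤ (R * s ^ i.j * cC * cH + cH * (K45 (d + 1) a L * ((L : ℝ) ^ i.j)⁻¹) * cH + cH * cC * (R * s ^ i.j)) * V ^ 2
          * Real.exp (-(κ / 2 * tdistT (ksU L i) Bx By)) := key
    _ ≤ (2 * (R * cC * cH) + cH * K45 (d + 1) a L * cH) * s ^ i.j * V ^ 2 * Real.exp (-(κ / 2 * tdistT (ksU L i) Bx By)) :=
        mul_le_mul_of_nonneg_right (mul_le_mul_of_nonneg_right hsum hV0) hE
    _ = (2 * (R * cC * cH) + cH * K45 (d + 1) a L * cH) * V ^ 2 * s ^ i.j * Real.exp (-(κ / 2 * tdistT (ksU L i) Bx By)) := by ring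
    _ ≤ ((2 * (R * cC * cH) + cH * K45 (d + 1) a L * cH) * V ^ 2 + 1) * s ^ i.j * Real.exp (-(κ / 2 * tdistT (ksU L i) Bx By)) :=
        mul_le_mul_of_nonneg_right (mul_le_mul_of_nonneg_right (by linarith) hsj) hE

/-! ## §2 The exact-mass family: the slices of (2.17) at their physical mass `m²(L^jη)²` -/

/-- THE PHYSICAL MASS OF THE MEMBER at index `i` in scale-`j` units: `m²(L^jη)² = m²·L^{−2(e+1−m₀)}` (`η = L^{−k}`, `k = j + (e+1−m₀)`,
King's rescaling (2.20) of the mass term). [cite: King1986, (2.20) p.654, (4.4) p.670 («m²(L^kε)²»)] -/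
def physMass (m2 : ℝ) (i : KSliceIdx d) : ℝ := m2 * (((L : ℝ) ^ (2 * (i.e + 1 - i.m₀)))⁻¹)

/-- The member mass is positive. [folklore] -/
theorem physMass_pos {m2 : ℝ} (hm : 0 < m2) (i : KSliceIdx d) : 0 < physMass L m2 i := by
  have hL0 : (0 : ℝ) < L := by exact_mod_cast Nat.pos_of_ne_zero (NeZero.ne L)
  unfold physMass
  positivity

omit [NeZero L] in
/-- The member mass is at most the physical mass (`L ≥ 1`). [cite: King1986, (2.20) p.654] -/
theorem physMass_le (hL : 1 ≤ L) {m2 : ℝ} (hm : 0 ≤ m2) (i : KSliceIdx d) : physMass L m2 i ≤ m2 := by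
  unfold physMass
  have h1 : (1 : ℝ) ≤ (L : ℝ) ^ (2 * (i.e + 1 - i.m₀)) := one_le_pow₀ (by exact_mod_cast hL)
  have h2 : ((L : ℝ) ^ (2 * (i.e + 1 - i.m₀)))⁻¹ ≤ 1 := inv_le_one_of_one_le₀ h1
  calc m2 * ((L : ℝ) ^ (2 * (i.e + 1 - i.m₀)))⁻¹ ≤ m2 * 1 := mul_le_mul_of_nonneg_left h2 hm
    _ = m2 := mul_one _

/-- `physMass = m²·(L^jη)²` with `L^jη = L^j·eps L k` the member's slice length. [cite: King1986, (2.20) p.654] -/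
theorem physMass_eq_slice_sq (m2 : ℝ) (i : KSliceIdx d) : physMass L m2 i = m2 * ((L : ℝ) ^ i.j * eps L i.k) ^ 2 := by
  have hL0 : (0 : ℝ) < L := by exact_mod_cast Nat.pos_of_ne_zero (NeZero.ne L)
  have hLj : (L : ℝ) ^ i.j ≠ 0 := pow_ne_zero _ hL0.ne'
  have hLt : (L : ℝ) ^ (i.e + 1 - i.m₀) ≠ 0 := pow_ne_zero _ hL0.ne'
  unfold physMass eps KSliceIdx.k
  rw [pow_mul', pow_add]
  field_simp

/-- **THE EXACT-MASS `A = 0` MEMBER FAMILY**: part G's slice datum at index `i` taken AT THE MEMBER'S PHYSICAL MASS `m²(L^jη)²` — by part K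
(`ksSlice_eq_sub`) its kernel IS King's slice `G^ε_{(j)} = G^ε_{j+1} − G^ε_j` of the decomposition (2.17) of the fluctuation propagator `G^η_k`
with physical mass `m²`, in scale-`j` lattice units. [cite: King1986, (2.17) p.653, (2.20) p.654, (4.42) p.675] -/
abbrev kSliceIndexPhys (a m2 : ℝ) (hL : 2 ≤ L) (i : KSliceIdx d) : SlicesIndex (d + 1) :=
  kSliceIndex L a (physMass L m2 i) hL i

/-- **(3.73) LINE 1 AT SLICE `j` FOR THE EXACT-MASS FAMILY — ONE `(C, δ)` FOR ALL VOLUMES, SLICES, RATIOS (hence all member masses)**: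
part G's `line1_kSlices` computation on §1's `ksSlice_rate_unif` at the cap `m₀² = m²`. [cite: King1986, Prop. 3.9 (3.73) p.665, (4.43) p.675, (2.20) p.654] -/
theorem line1_kSlicesPhys (hd : 1 ≤ d) (hLodd : Odd L) (hL : 2 ≤ L) {a m2 : ℝ} (ha : 0 < a) (hm : 0 < m2) {γ : ℝ} (hγ0 : 0 ≤ γ)
    (hγ1 : γ ≤ 1) :
    ∃ C δ : ℝ, 0 < C ∧ 0 < δ ∧ ∀ (i : KSliceIdx d) (x' y' : (kSliceData L a (physMass L m2 i) i).hi.S),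
      |(kSliceData L a (physMass L m2 i) i).hi.G i.j x' y'
          - (kSliceData L a (physMass L m2 i) i).lo.G i.j ((kSliceData L a (physMass L m2 i) i).pt x')
              ((kSliceData L a (physMass L m2 i) i).pt y')|
        ≤ C * ((kSliceData L a (physMass L m2 i) i).lo.L : ℝ) ^ (-(γ / 2 * (kSliceData L a (physMass L m2 i) i).lo.k))
          * ((kSliceData L a (physMass L m2 i) i).lo.slice i.j) ^ ((2 : ℝ) - ((d + 1 : ℕ) : ℝ) - γ / 2)
          * Real.exp (-(δ * ((kSliceData L a (physMass L m2 i) i).lo.slice i.j)⁻¹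
              * (kSliceData L a (physMass L m2 i) i).lo.dist ((kSliceData L a (physMass L m2 i) i).pt x')
                ((kSliceData L a (physMass L m2 i) i).pt y'))) := by
  have hL0 : 0 < L := by omega
  obtain ⟨C, δ, hC, hδ, H⟩ := ksSlice_rate_unif (d := d) L hLodd hL ha hm.le hγ0 hγ1
  refine ⟨C, δ, hC, hδ, fun i x' y' => ?_⟩
  have h := H (physMass L m2 i) (physMass_pos L hm i) (physMass_le L (by omega) hm.le i) i x' y'
  have hsl : (kSliceData L a (physMass L m2 i) i).lo.slice i.j = (L : ℝ) ^ i.j * eps L i.k := rfl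
  obtain ⟨hsl0, hsl1⟩ := kSlice_slice_pos_le_one (L := L) (by omega) (le_of_lt i.j_succ_le_k)
  set sl : ℝ := (L : ℝ) ^ i.j * eps L i.k with hsl_def
  set t : ℝ := tdistT (ksU L i) (blockOf (L ^ i.j) (ksU L i) (underPtN L i.j i.n (ksU L i) x'))
    (blockOf (L ^ i.j) (ksU L i) (underPtN L i.j i.n (ksU L i) y')) with ht
  have hexp : Real.exp (-(δ * sl⁻¹ * (sl * t))) = Real.exp (-(δ * t)) := by
    rw [mul_assoc, inv_mul_cancel_left₀ hsl0.ne']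
  have hrate : ((L : ℝ) ^ (-(γ / 2))) ^ i.j = (L : ℝ) ^ (-(γ / 2 * i.k)) * sl ^ (-(γ / 2)) :=
    (slice_rate_identity L hL0 (γ / 2) i.j i.k).symm
  have hd' : (2 : ℝ) - ((d + 1 : ℕ) : ℝ) - γ / 2 ≤ -(γ / 2) := by
    have : (1 : ℝ) ≤ d := by exact_mod_cast hd
    push_cast
    linarith
  have hpref : sl ^ (-(γ / 2)) ≤ sl ^ ((2 : ℝ) - ((d + 1 : ℕ) : ℝ) - γ / 2) :=
    Real.rpow_le_rpow_of_exponent_ge hsl0 hsl1 hd'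
  have hLk : 0 ≤ (L : ℝ) ^ (-(γ / 2 * i.k)) := Real.rpow_nonneg (Nat.cast_nonneg _) _
  rw [hsl, hexp]
  calc |ksSlice' L a (physMass L m2 i) i x' y'
          - ksSlice L a (physMass L m2 i) i (underPtN L i.j i.n (ksU L i) x') (underPtN L i.j i.n (ksU L i) y')|
      ≤ C * ((L : ℝ) ^ (-(γ / 2))) ^ i.j * Real.exp (-(δ * t)) := h
    _ = C * ((L : ℝ) ^ (-(γ / 2 * i.k)) * sl ^ (-(γ / 2))) * Real.exp (-(δ * t)) := by rw [hrate]
    _ ≤ C * ((L : ℝ) ^ (-(γ / 2 * i.k)) * sl ^ ((2 : ℝ) - ((d + 1 : ℕ) : ℝ) - γ / 2)) * Real.exp (-(δ * t)) :=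
        mul_le_mul_of_nonneg_right (mul_le_mul_of_nonneg_left (mul_le_mul_of_nonneg_left hpref hLk) hC.le) (Real.exp_pos _).le
    _ = C * (L : ℝ) ^ (-(γ / 2 * i.k)) * sl ^ ((2 : ℝ) - ((d + 1 : ℕ) : ℝ) - γ / 2) * Real.exp (-(δ * t)) := by ring

/-- **THE TYPED SITE INEQUALITY FOR THE EXACT-MASS MEMBERS**: ONE `(C, δ)` with `EtaRateIneqSite (d+1) (−2) (slicesGSite (kSliceIndexPhys …)) C δ (γ∕2) U`
for EVERY index (part E's exact dictionary). [cite: King1986, Prop. 3.9 (3.73) p.665; Balaban1985BackgroundPropagators, Thm 3.2 (3.48) p.398 + (3.132) p.422 (shape)] -/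
theorem etaRateIneqSite_kSlicesPhys (hd : 1 ≤ d) (hLodd : Odd L) (hL : 2 ≤ L) {a m2 : ℝ} (ha : 0 < a) (hm : 0 < m2) {γ : ℝ}
    (hγ0 : 0 ≤ γ) (hγ1 : γ ≤ 1) :
    ∃ C δ : ℝ, 0 < C ∧ 0 < δ ∧ ∀ (i : KSliceIdx d) (U : (slicesInstance (kSliceIndexPhys L a m2 hL i)).Bf.Cfg),
      EtaRateIneqSite (d + 1) (-2) (slicesGSite (kSliceIndexPhys L a m2 hL i)) C δ (γ / 2) U := by
  obtain ⟨C, δ, hC, hδ, H⟩ := line1_kSlicesPhys (d := d) L hd hLodd hL ha hm hγ0 hγ1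
  exact ⟨C, δ, hC, hδ, fun i U => (etaRateIneqSite_slicesG_iff_line1 (kSliceIndexPhys L a m2 hL i) C δ (γ / 2) U).2 (H i)⟩

/-- **`NE2PlusSite` FOR THE SLICES OF KING'S (2.17) AT THEIR PHYSICAL MASSES, HYPOTHESIS-FREE, ONE `(C, δ)` FOR THE WHOLE FAMILY** (`d ≥ 1`,
odd `L ≥ 3`, `a, m² > 0`, `0 < γ ≤ 1`; every `c35`): the `A = 0` member class of parts D–E IS King's decomposition of the fluctuation propagator
with its (2.20) mass bookkeeping — part F's HONEST SCOPE (iii) no longer applies.  HONEST SCOPE: `A = 0`, one-point backgrounds, lattice units,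
NOT the sum over slices, NOT a discharge. [cite: King1986, (2.17) p.653, (2.20) p.654, Prop. 3.9 (3.73) p.665, (4.42)–(4.43) p.675; Balaban1985BackgroundPropagators, Thm 3.2 (3.48) p.398 + Thm 3.14 pp.426–427 (quantifier template)] -/
theorem ne2PlusSite_kSlicesPhys (hd : 1 ≤ d) (hLodd : Odd L) (hL : 2 ≤ L) {a m2 : ℝ} (ha : 0 < a) (hm : 0 < m2) {γ : ℝ}
    (hγ0 : 0 < γ) (hγ1 : γ ≤ 1) (c35 : ℝ) :
    NE2PlusSite (d + 1) (-2) c35 (fun i : KSliceIdx d => slicesInstance (kSliceIndexPhys L a m2 hL i))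
      (fun i => slicesGSite (kSliceIndexPhys L a m2 hL i)) := by
  obtain ⟨C, δ, hC, hδ, H⟩ := line1_kSlicesPhys (d := d) L hd hLodd hL ha hm hγ0.le hγ1
  exact ne2PlusSite_slicesG_of_line1 (kSliceIndexPhys L a m2 hL) hC hδ (half_pos hγ0) H c35

/-- `NE2ZeroSite` for the exact-mass members. [cite: King1986, Prop. 3.9 (3.73) p.665] -/
theorem ne2ZeroSite_kSlicesPhys (hd : 1 ≤ d) (hLodd : Odd L) (hL : 2 ≤ L) {a m2 : ℝ} (ha : 0 < a) (hm : 0 < m2) {γ : ℝ}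
    (hγ0 : 0 < γ) (hγ1 : γ ≤ 1) :
    NE2ZeroSite (d + 1) (-2) (fun i : KSliceIdx d => slicesInstance (kSliceIndexPhys L a m2 hL i))
      (fun i => slicesGSite (kSliceIndexPhys L a m2 hL i)) :=
  ne2ZeroSite_of_ne2PlusSite (c35 := 0) (fun _ _ _ => trivial) (ne2PlusSite_kSlicesPhys L hd hLodd hL ha hm hγ0 hγ1 0)


/-! ## §3 (v1.1) The DECAY of the slice kernel, one constant pair for all masses — the input of the successor's induction (PART O-a) -/

open Literature.MathematicalPhysics.QuantumFieldTheory.King1986 (triple_decay_bound)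

/-- **Decay of a triple contraction of decaying legs and kernel** (F₀'s selector trick on `King1986.triple_decay_bound`):
`|Σ_w(Σ_z f(z)C(z,w))g(w)| ≤ αcβ·V²·e^{−(κ∕2)d(u₀,v₀)}`. [cite: King1986, (4.41) p.675] -/
theorem triple_decay {U : Type*} [Fintype U] [DecidableEq U] (dist : U → U → ℝ) (hd0 : ∀ u v, 0 ≤ dist u v)
    (htri : ∀ u v w, dist u w ≤ dist u v + dist v w) {f g : U → ℝ} {C : Matrix U U ℝ} {u₀ v₀ : U}
    {κ α c β V : ℝ} (hκ : 0 ≤ κ) (hα : 0 ≤ α) (hc : 0 ≤ c) (hβ : 0 ≤ β)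
    (hf : ∀ z, |f z| ≤ α * Real.exp (-(κ * dist u₀ z))) (hC : ∀ z w, |C z w| ≤ c * Real.exp (-(κ * dist z w)))
    (hg : ∀ w, |g w| ≤ β * Real.exp (-(κ * dist w v₀))) (hV : ∀ u, ∑ z, Real.exp (-(κ / 2 * dist u z)) ≤ V) :
    |triple f C g| ≤ α * c * β * V ^ 2 * Real.exp (-(κ / 2 * dist u₀ v₀)) := by
  have h := triple_decay_bound dist hd0 htri (rowSel f u₀) C (colSel g v₀) hκ hα hc (abs_rowSel_le hα hf) hC
    (abs_colSel_le hβ hg) hV u₀ v₀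
  rwa [← triple_eq_selectors] at h

/-- **THE DECAY OF KING'S SLICE KERNEL AT `A = 0`, ONE `(C, δ)` FOR ALL MASSES `0 < m² ≤ m₀²`, both runs**: for every index and all points,
`|ksSlice(x, y)| ≤ C·e^{−δ|B(x) − B(y)|_U}` and `|ksSlice′(x′, y′)| ≤ C·e^{−δ|B(x′) − B(y′)|_U}` (King's (3.64)-type decay of the slice
`G_{(j)} = ℋ_jC^{(j)}ℋ_jᵀ` from the decay of its three factors — `ksH_decay_unif`, n15-d's `kingCov_abs_le` — at the common rate, one block sum each side).
[cite: King1986, Prop. 3.7 (3.64) p.663, (4.34) p.674, (4.41)–(4.42) p.675] -/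
theorem ksSlice_decay_unif (hLodd : Odd L) (hL : 2 ≤ L) {a : ℝ} (ha : 0 < a) {m0sq : ℝ} (hm0 : 0 ≤ m0sq) :
    ∃ C δ : ℝ, 0 < C ∧ 0 < δ ∧ ∀ (m2 : ℝ), 0 < m2 → m2 ≤ m0sq → ∀ (i : KSliceIdx d),
      (∀ x y : Tor (fine (L ^ i.j) (ksU L i)),
        |ksSlice L a m2 i x y| ≤ C * Real.exp (-(δ * tdistT (ksU L i) (blockOf (L ^ i.j) (ksU L i) x) (blockOf (L ^ i.j) (ksU L i) y)))) ∧
      (∀ x' y' : Tor (fine (L ^ i.n * L ^ i.j) (ksU L i)),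
        |ksSlice' L a m2 i x' y'|
          ≤ C * Real.exp (-(δ * tdistT (ksU L i) (blockOf (L ^ i.n * L ^ i.j) (ksU L i) x') (blockOf (L ^ i.n * L ^ i.j) (ksU L i) y')))) := by
  obtain ⟨δ₀, cH, hδ₀, hcH, Hdec⟩ := ksH_decay_unif (d := d) L hLodd hL ha hm0
  have hcC := ksC_const_pos (d := d) L hL ha
  obtain ⟨hκ', _⟩ := kapCT_pos_le (d := d + 1) ha hL
  obtain ⟨κ, hκ, hκ₀, hκC⟩ : ∃ κ : ℝ, 0 < κ ∧ κ ≤ δ₀ ∧ κ ≤ kapCT (d + 1) a L :=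
    ⟨min δ₀ (kapCT (d + 1) a L), lt_min hδ₀ hκ', min_le_left _ _, min_le_right _ _⟩
  set cC : ℝ := (gam0L (d + 1) a L - (kingRho (d + 1) a L + kingRhoB (d + 1) a L))⁻¹ with hcC_def
  refine ⟨cH * cC * cH * latticeConst (d + 1) (κ / 2) ^ 2 + 1, κ / 2, by positivity, half_pos hκ, fun m2 hm hcap i => ?_⟩
  have ht0 := tdistT_nonneg (ksU L i)
  have exp_rate_mono : ∀ {κ' r t : ℝ}, κ' ≤ r → 0 ≤ t → Real.exp (-(r * t)) ≤ Real.exp (-(κ' * t)) :=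
    fun hκr ht => Real.exp_le_exp.mpr (by nlinarith)
  have hVs : ∀ u : Tor (ksU L i), ∑ z, Real.exp (-(κ / 2 * tdistT (ksU L i) u z)) ≤ latticeConst (d + 1) (κ / 2) := fun u =>
    tdistT_sumBound (ksU L i) (κ / 2) (half_pos hκ) u
  constructor
  · intro x y
    have hA : ∀ z, |ksH L a m2 i x z| ≤ cH * Real.exp (-(κ * tdistT (ksU L i) (blockOf (L ^ i.j) (ksU L i) x) z)) := fun z =>
      ((Hdec m2 hm.le hcap i).1 x z).trans (mul_le_mul_of_nonneg_left (exp_rate_mono hκ₀ (ht0 _ _)) hcH.le)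
    have hB : ∀ w, |ksH L a m2 i y w| ≤ cH * Real.exp (-(κ * tdistT (ksU L i) w (blockOf (L ^ i.j) (ksU L i) y))) := fun w => by
      rw [tdistT_symm]
      exact ((Hdec m2 hm.le hcap i).1 y w).trans (mul_le_mul_of_nonneg_left (exp_rate_mono hκ₀ (ht0 _ _)) hcH.le)
    have hCm : ∀ z w, |ksC L a m2 i z w| ≤ cC * Real.exp (-(κ * tdistT (ksU L i) z w)) := fun z w =>
      ((ksC_decay L hL ha hm i z w).1).trans (mul_le_mul_of_nonneg_left (exp_rate_mono hκC (ht0 _ _)) hcC.le)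
    have key := triple_decay (tdistT (ksU L i)) ht0 (tdistT_triangle (ksU L i)) hκ.le hcH.le hcC.le hcH.le hA hCm hB hVs
    refine key.trans (mul_le_mul_of_nonneg_right (by nlinarith [sq_nonneg (latticeConst (d + 1) (κ / 2))]) (Real.exp_pos _).le)
  · intro x' y'
    have hA : ∀ z, |ksH' L a m2 i x' z| ≤ cH * Real.exp (-(κ * tdistT (ksU L i) (blockOf (L ^ i.n * L ^ i.j) (ksU L i) x') z)) :=
      fun z => ((Hdec m2 hm.le hcap i).2 x' z).trans (mul_le_mul_of_nonneg_left (exp_rate_mono hκ₀ (ht0 _ _)) hcH.le)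
    have hB : ∀ w, |ksH' L a m2 i y' w| ≤ cH * Real.exp (-(κ * tdistT (ksU L i) w (blockOf (L ^ i.n * L ^ i.j) (ksU L i) y'))) :=
      fun w => by
        rw [tdistT_symm]
        exact ((Hdec m2 hm.le hcap i).2 y' w).trans (mul_le_mul_of_nonneg_left (exp_rate_mono hκ₀ (ht0 _ _)) hcH.le)
    have hCm : ∀ z w, |ksC' L a m2 i z w| ≤ cC * Real.exp (-(κ * tdistT (ksU L i) z w)) := fun z w =>
      ((ksC_decay L hL ha hm i z w).2).trans (mul_le_mul_of_nonneg_left (exp_rate_mono hκC (ht0 _ _)) hcC.le)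
    have key := triple_decay (tdistT (ksU L i)) ht0 (tdistT_triangle (ksU L i)) hκ.le hcH.le hcC.le hcH.le hA hCm hB hVs
    refine key.trans (mul_le_mul_of_nonneg_right (by nlinarith [sq_nonneg (latticeConst (d + 1) (κ / 2))]) (Real.exp_pos _).le)

end Summit.QuantumFields.YangMills.BalabanUVNodes.N15KingModelRung.Curved
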